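/-
Origin: expansion seat `planner-pub-hodgecm-pohl-g9-0`, handover #3 2026-08-18T08:18:24Z (`HOME/pub-hodgecm-pohl-g9/lean/Pohl9/NonGaloisInduced.lean`, md5 e3dabd1c, 118 lines);
landed by the gen-7 packager in gate run 26 as `HodgeCM/Proofs/Pohlmann/NonGaloisInduced.lean` (import ^import Pohl9\.→import HodgeCM.Proofs.Pohlmann. ×1).
-/
/-
Copyright: pub-hodgecm formalisation cell (harness21, 2026). New file (not vendored).
Origin: HOME/pub-hodgecm-pohl-g9/lean/Pohl9/NonGaloisInduced.lean — session planner-pub-hodgecm-pohl-g9-0 (unit pub-hodgecm-pohl-g9),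
EXPANSION part (b) `PohlmannSpan`, generation 9.  Intended final place: `HodgeCM/Proofs/Pohlmann/NonGaloisInduced.lean`
(module `HodgeCM.Proofs.Pohlmann.NonGaloisInduced`).  ADDITIVE leaf.  WIP import `Pohl9.NonGaloisIndex` = the handed-over
`HodgeCM/Proofs/Pohlmann/NonGaloisIndex.lean` (rewrite to `import HodgeCM.Proofs.Pohlmann.NonGaloisIndex` on landing).
-/
import Summits.HodgeConjecture.HodgeCM.Proofs.Pohlmann.NonGaloisIndex

/-!
# The induced CM type, constructed — hypotheses of `not_naivePohlmannSpanAt` made elementary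

`NonGaloisIndex.lean` refutes the naive (old-index-set) Pohlmann span at `(F, Θ, p = 1)` under three hypotheses on `(F, Θ)`:
`AutPair F` (`Aut(F/ℚ) = {1, c}`), `GalStableType Θ` and "`Θ` has two elements".  Here the last two are DISCHARGED by a construction:
for a ring map `i : K → F` from a field `K` with exactly two complex embeddings `k₀ ≠ k̄₀` (an imaginary quadratic field, in embedding
terms), `NonGalois.subfieldType i k₀` is the CM type `{s : s ∘ i = k₀}` of `F` (kernel: it IS a CM type), it is Galois-stable up to
conjugation (`galStableType_subfieldType`, from `galStableType_of_induced`), and every CM type of a CM field of degree `≥ 4` has two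
elements (`NonGalois.exists_ne_of_four_le`: `#Θ = #Θ̄` and `#Θ + #Θ̄ = [F:ℚ]`).  Net statement `Universe.not_naivePohlmannSpanAt_subfieldType`:
for every CM field `F` with `Aut(F/ℚ) = {1, c}` and `[F:ℚ] ≥ 4` receiving such a `K`, the body of `PohlmannSpan` with the old index set
FAILS at `(F, Θ_{K}, p = 1)` in every universe with the model axioms and N1–N4.  (`[F:ℚ] ≥ 6` is allowed, so the degree hypothesis of
`PohlmannSpan` does not rescue the old index set either; only `IsGalois ℚ F` does, `isHodgeWeight_iff_isHodgeWeightC`.)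
-/

noncomputable section

open scoped TensorProduct NumberField BigOperators
open NumberField NumberField.ComplexEmbedding

attribute [local instance] Classical.propDecidable

namespace HodgeCM

open Literature.AlgebraicGeometry.Motives (CMType)
open HodgeCM.GaoUllmo HodgeCM.CMTypeOps

namespace NonGalois

section Induced

variable {F : Type} [Field F] {K : Type} [Field K]

/-- (Ported verbatim from the HodgeCMPerL package; no docstring in the source.) -/
theorem conjugate_comp (s : F →+* ℂ) (i : K →+* F) : (conjugate s).comp i = conjugate (s.comp i) :=
  RingHom.ext fun x => by rw [RingHom.comp_apply, conjugate_coe_eq, conjugate_coe_eq, RingHom.comp_apply]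

/-- The CM type of `F` INDUCED from the embedding `k₀` of `K` along `i : K → F`, when `K` has exactly the two complex embeddings
`k₀ ≠ k̄₀`: `Θ = {s : s ∘ i = k₀}`.  (The special case `Φ = {k₀}` of `HodgeCM.Toy.inducedType K F i Φ` (Model/Toy/Isogeny.lean), stated
for an unbundled field `K` so that no CM structure on `K` has to be supplied.) -/
def subfieldType (i : K →+* F) (k₀ : K →+* ℂ) (hK : ∀ k : K →+* ℂ, k = k₀ ∨ k = conjugate k₀) (hk : conjugate k₀ ≠ k₀) :
    CMType F :=
  ⟨{s | s.comp i = k₀}, fun s => by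
    simp only [Set.mem_setOf_eq, conjugate_comp]
    constructor
    · intro h h'
      rw [h] at h'
      exact hk h'
    · intro h
      rcases hK (s.comp i) with h1 | h1
      · exact h1
      · exact absurd (by rw [h1, involutive_conjugate K k₀]) h⟩

/-- (Ported verbatim from the HodgeCMPerL package; no docstring in the source.) -/
@[simp] theorem mem_subfieldType (i : K →+* F) (k₀ : K →+* ℂ) (hK : ∀ k : K →+* ℂ, k = k₀ ∨ k = conjugate k₀)
    (hk : conjugate k₀ ≠ k₀) (s : F →+* ℂ) : s ∈ (subfieldType i k₀ hK hk).1 ↔ s.comp i = k₀ :=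
  Iff.rfl

/-- (Ported verbatim from the HodgeCMPerL package; no docstring in the source.) -/
theorem galStableType_subfieldType [NumberField F] (i : K →+* F) (k₀ : K →+* ℂ) (hK : ∀ k : K →+* ℂ, k = k₀ ∨ k = conjugate k₀)
    (hk : conjugate k₀ ≠ k₀) : GalStableType (subfieldType i k₀ hK hk) :=
  galStableType_of_induced i k₀ _ fun _ => Iff.rfl

end Induced

section Card

variable {F : Type} [Field F] [NumberField F]

/-- Every CM type of a field of degree `≥ 4` has two distinct elements (`#Θ = #Θ̄`, `#Θ + #Θ̄ = [F:ℚ]`). -/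
theorem exists_ne_of_four_le (Θ : CMType F) (h4 : 4 ≤ Module.finrank ℚ F) : ∃ s₁ ∈ Θ.1, ∃ s₂ ∈ Θ.1, s₁ ≠ s₂ := by
  set T : Finset (F →+* ℂ) := Finset.univ.filter (· ∈ Θ.1) with hT
  have hmem : ∀ s, s ∈ T ↔ s ∈ Θ.1 := fun s => by simp [hT]
  have hle : Tᶜ.card ≤ T.card := by
    refine Finset.card_le_card_of_injOn conjugate (fun s hs => ?_) (involutive_conjugate F).injective.injOn
    rw [Finset.mem_coe, Finset.mem_compl, hmem] at hs
    rw [Finset.mem_coe, hmem]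
    exact (conjugate_mem_iff_notMem Θ s).mpr hs
  have hsum : T.card + Tᶜ.card = Module.finrank ℚ F := by
    rw [Finset.card_add_card_compl, Embeddings.card]
  obtain ⟨a, ha, b, hb, hab⟩ := Finset.one_lt_card.mp (by omega : 1 < T.card)
  exact ⟨a, (hmem a).mp ha, b, (hmem b).mp hb, hab⟩

end Card

end NonGalois

namespace Universe

open NonGalois

variable {U : Universe}

/-- `not_naivePohlmannSpanAt` with "two elements of `Θ`" replaced by `[F:ℚ] ≥ 4`. -/
theorem not_naivePohlmannSpanAt' (M : U.ModelAxioms) (hN1 : U.Fact_cupExterior) (hN2 : U.Fact_cup_hodge)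
    (hN3 : U.Fact_pull_H0) (hN4 : U.Fact_hodge_F0) (F : CMField) (hA : AutPair F) (Θ : CMType F) (hΘ : GalStableType Θ)
    (h4 : 4 ≤ Module.finrank ℚ F) : ¬ U.NaivePohlmannSpanAt F (fun _ : Fin 1 => Θ) 1 :=
  not_naivePohlmannSpanAt M hN1 hN2 hN3 hN4 F hA Θ hΘ (exists_ne_of_four_le Θ h4)

/-- **The naive Pohlmann span fails at an induced type.**  For every CM field `F` with `Aut(F/ℚ) = {1, c}` and `[F:ℚ] ≥ 4`, every
ring map `i : K → F` from a field with exactly two complex embeddings `k₀ ≠ k̄₀`, and every universe with the model axioms and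
N1–N4: `B¹(A_Θ) ⊗ 1 ⊄ span_ℂ {weight vectors of the OLD Hodge weights}` for `Θ = {s : s ∘ i = k₀}`. -/
theorem not_naivePohlmannSpanAt_subfieldType (M : U.ModelAxioms) (hN1 : U.Fact_cupExterior) (hN2 : U.Fact_cup_hodge)
    (hN3 : U.Fact_pull_H0) (hN4 : U.Fact_hodge_F0) (F : CMField) (hA : AutPair F) (h4 : 4 ≤ Module.finrank ℚ F)
    {K : Type} [Field K] (i : K →+* F) (k₀ : K →+* ℂ) (hK : ∀ k : K →+* ℂ, k = k₀ ∨ k = conjugate k₀) (hk : conjugate k₀ ≠ k₀) :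
    ¬ U.NaivePohlmannSpanAt F (fun _ : Fin 1 => subfieldType i k₀ hK hk) 1 :=
  not_naivePohlmannSpanAt' M hN1 hN2 hN3 hN4 F hA _ (galStableType_subfieldType i k₀ hK hk) h4

end Universe

end HodgeCM

end
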